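import Literature.Analysis.FluidPDE.ScalarTransportMaxPrinciple
import Literature.Analysis.FluidPDE.ScalarTransportDuality
import Literature.Analysis.FluidPDE.PassiveScalarClassicalEnergy
import Literature.Analysis.FunctionSpaces.TorusMollifier
import HarnessLib

/-!
# The reversed kernel family of a smooth incompressible drift

Analysis/FluidPDE proof-support file (everything proved). Fix a smooth divergence-free drift
`u` on `[0,T] × T^d`, a diffusivity `κ > 0` and a mollifier radius `ε`. The **reversed kernel
family** is the family `χ = (χ^w)_{w ∈ T^d}` of classical solutions of

  `∂_τ χ^w - u(T - τ)·∇χ^w = κ Δχ^w` on `[0,T] × T^d`,  `χ^w(0) = k_ε(· - w)`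

(`Torus.kernel ε` the torus mollifier), i.e. the advection–diffusion equation run backwards
from the final time `T` with the diffusing bump `k_ε(· - w)` as final datum: `χ^w(τ, ·)` is the
(mollified) density at time `T - τ` of the backward stochastic characteristic started at time
`T` near `w`. This file records the elementary properties consumed by the two-point dissipation
bound for releases:

* existence (`exists_reversedKernelFamily`, from the tree's classical well-posedness);
* positivity and the sup bound (`reversedKernel_nonneg`, `reversedKernel_le`; maximum principle),
  unit mass (`integral_reversedKernel_eq_one`; conservation of the mean);
* equicontinuity in the parameter `w` (`reversedKernel_abs_sub_le`, sup-norm contraction) and the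
  resulting **joint continuity** of `(w, τ, x) ↦ χ^w(τ, x)` (`continuousOn_reversedKernel`), which makes
  all superpositions `∫ … dw` honest Bochner integrals with Fubini available.

The marginal identity `∫ χ^w(τ,x) dw = 1` (incompressibility, by duality) is proved downstream.
Everything is stated for an arbitrary family `χ` satisfying the two defining properties
(`hχ`, `hχ0`), so that no new definition is introduced.

## References

* G. Crippa, C. De Lellis, J. reine angew. Math. 616 (2008), §2 (backward characteristics and
  two-point functionals for Sobolev drifts).
* L. C. Evans, *Partial Differential Equations*, 2nd ed. (2010), §7.1 (classical parabolic
  theory; maximum principle §7.1.4). [`Evans2010`]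
-/

noncomputable section

open MeasureTheory Set Filter Topology Function Metric
open scoped InnerProductSpace ContDiff Convolution
open Literature.Analysis.FunctionSpaces Literature.Analysis.FunctionSpaces.Torus

namespace Literature.Analysis.FluidPDE

namespace Torus

variable {d : Type*} [Fintype d] [DecidableEq d]

/-! ## Joint continuity of jointly smooth fields on `S × T^d` -/

omit [Fintype d] [DecidableEq d] in
/-- A field whose space–time lift is continuous on `S × ℝ^d` is jointly continuous on
`S × T^d` (tube lemma in time, uniformly in space, plus continuity of the slices). [folklore] -/
theorem continuousOn_uncurry_of_stLift_continuousOn {F : Type*} [NormedAddCommGroup F]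
    {S : Set ℝ} {u : ℝ → UnitAddTorus d → F} (hu : ContinuousOn (stLift u) (S ×ˢ univ)) :
    ContinuousOn (uncurry u) (S ×ˢ univ) := by
  rintro ⟨t, x⟩ ⟨ht, -⟩
  rw [ContinuousWithinAt, Metric.tendsto_nhds]
  intro δ hδ
  have h1 := eventually_norm_sub_lt_of_continuousOn hu ht (half_pos hδ)
  -- continuity of the slice `u t` at `x`, through the lift
  have hslice : ContinuousAt (u t) x := by
    have hc : Continuous (fun y : EuclideanSpace ℝ d => stLift u (t, y)) :=
      (hu.comp_continuous (continuous_const.prodMk continuous_id) fun y => ⟨ht, mem_univ _⟩)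
    have e : (fun y : EuclideanSpace ℝ d => stLift u (t, y)) = lift (u t) := rfl
    rw [e, continuous_lift_iff] at hc
    exact hc.continuousAt
  have h2 : ∀ᶠ y in 𝓝 x, dist (u t y) (u t x) < δ / 2 := Metric.tendsto_nhds.1 hslice _ (half_pos hδ)
  have h12 : ∀ᶠ p : ℝ × UnitAddTorus d in 𝓝[S ×ˢ univ] (t, x),
      (∀ y, ‖u p.1 y - u t y‖ < δ / 2) ∧ dist (u t p.2) (u t x) < δ / 2 := by
    rw [nhdsWithin_prod_eq, nhdsWithin_univ]
    exact h1.prod_mk h2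
  filter_upwards [h12] with p hp
  calc dist (uncurry u p) (uncurry u (t, x)) ≤ dist (u p.1 p.2) (u t p.2) + dist (u t p.2) (u t x) :=
        dist_triangle _ _ _
    _ < δ / 2 + δ / 2 := add_lt_add (by rw [dist_eq_norm]; exact hp.1 p.2) hp.2
    _ = δ := add_halves δ

omit [DecidableEq d] in
/-- Jointly smooth fields are jointly continuous on `S × T^d`. [folklore] -/
theorem _root_.Literature.Analysis.FunctionSpaces.Torus.IsSmoothSpaceTimeOn.continuousOn_uncurry
    {F : Type*} [NormedAddCommGroup F] [NormedSpace ℝ F] {S : Set ℝ} {u : ℝ → UnitAddTorus d → F}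
    (hu : IsSmoothSpaceTimeOn S u) : ContinuousOn (uncurry u) (S ×ˢ univ) :=
  continuousOn_uncurry_of_stLift_continuousOn hu.continuousOn_stLift

/-! ## The reversed kernel family -/

section Family

variable {κ T ε : ℝ} {u : ℝ → UnitAddTorus d → EuclideanSpace ℝ d}
  {χ : UnitAddTorus d → ℝ → UnitAddTorus d → ℝ}

omit [DecidableEq d] in
/-- Translates of the mollifier are smooth. [folklore] -/
theorem isSmooth_kernel_sub (hε : 0 < ε) (hε4 : ε ≤ 1 / 4) (w : UnitAddTorus d) :
    IsSmooth fun x : UnitAddTorus d => kernel ε (x - w) := by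
  simpa [sub_eq_add_neg] using (isSmooth_kernel hε hε4).comp_add_right (-w)

omit [DecidableEq d] in
/-- Translates of the mollifier have unit mass. [folklore] -/
theorem integral_kernel_sub (hε : 0 < ε) (hε4 : ε ≤ 1 / 4) (w : UnitAddTorus d) :
    ∫ x, kernel (d := d) ε (x - w) = 1 := by
  rw [integral_sub_right_eq_self (fun x => kernel (d := d) ε x) w, integral_kernel hε hε4]

omit [DecidableEq d] in
/-- `∫ k_ε(x - w) dw = 1` (mass of the reflected translate). [folklore] -/
theorem integral_kernel_sub_left (hε : 0 < ε) (hε4 : ε ≤ 1 / 4) (x : UnitAddTorus d) :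
    ∫ w, kernel (d := d) ε (x - w) = 1 := by
  rw [integral_sub_left_eq_self (fun w => kernel (d := d) ε w) volume x, integral_kernel hε hε4]

/-- **Existence of the reversed kernel family**: for a smooth divergence-free drift on `[0,T]`,
`κ > 0` and `0 < ε ≤ 1/4`, there are classical solutions `χ^w` of the equation with reversed
drift `σ ↦ -u(T - σ)` and data `k_ε(· - w)`, one for every `w ∈ T^d`. [folklore] -/
theorem exists_reversedKernelFamily (hκ : 0 < κ) (hT : 0 < T) (hu : IsSmoothSpaceTimeOn (Icc 0 T) u)
    (hdiv : ∀ t ∈ Icc 0 T, IsDivFree (u t)) (hε : 0 < ε) (hε4 : ε ≤ 1 / 4) :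
    ∃ χ : UnitAddTorus d → ℝ → UnitAddTorus d → ℝ,
      (∀ w, IsClassicalScalarTransportOn (Icc 0 T) κ (fun τ x => -u (T - τ) x) (χ w)) ∧
      (∀ w x, χ w 0 x = kernel ε (x - w)) := by
  have hv : IsSmoothSpaceTimeOn (Icc 0 T) (fun τ x => -u (T - τ) x) := isSmoothSpaceTimeOn_reverse_neg hu
  have hvdiv := isDivFree_reverse hdiv
  have h : ∀ w, ∃ θ : ℝ → UnitAddTorus d → ℝ,
      IsClassicalScalarTransportOn (Icc 0 T) κ (fun τ x => -u (T - τ) x) θ ∧ θ 0 = fun x => kernel ε (x - w) := by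
    intro w
    obtain ⟨θ, hθ, h0, -⟩ := exists_unique_isClassicalScalarTransportOn_of_forced
      exists_unique_isClassicalScalarTransportForcedOn_holds hκ hT hv hvdiv (isSmooth_kernel_sub hε hε4 w)
    exact ⟨θ, hθ, h0⟩
  choose χ hχ hχ0 using h
  exact ⟨χ, hχ, fun w x => congrFun (hχ0 w) x⟩

/-- **Positivity** of the reversed kernels (maximum principle). [folklore] -/
theorem reversedKernel_nonneg (hκ : 0 ≤ κ) (hε : 0 ≤ ε)
    (hχ : ∀ w, IsClassicalScalarTransportOn (Icc 0 T) κ (fun τ x => -u (T - τ) x) (χ w))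
    (hχ0 : ∀ w x, χ w 0 x = kernel ε (x - w)) (w : UnitAddTorus d) {τ : ℝ} (hτ : τ ∈ Icc 0 T)
    (x : UnitAddTorus d) : 0 ≤ χ w τ x :=
  (hχ w).nonneg_of_nonneg hκ (fun y => by rw [hχ0]; exact kernel_nonneg hε _) τ hτ x

/-- **Sup bound** of the reversed kernels: `χ^w ≤ sup k_ε` (maximum principle). [folklore] -/
theorem reversedKernel_le (hκ : 0 ≤ κ) {K : ℝ} (hK : ∀ z, kernel (d := d) ε z ≤ K)
    (hχ : ∀ w, IsClassicalScalarTransportOn (Icc 0 T) κ (fun τ x => -u (T - τ) x) (χ w))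
    (hχ0 : ∀ w x, χ w 0 x = kernel ε (x - w)) (w : UnitAddTorus d) {τ : ℝ} (hτ : τ ∈ Icc 0 T)
    (x : UnitAddTorus d) : χ w τ x ≤ K :=
  (hχ w).le_of_le hκ (fun y => by rw [hχ0]; exact hK _) τ hτ x

/-- **Unit mass** of the reversed kernels (conservation of the mean). [folklore] -/
theorem integral_reversedKernel_eq_one (hε : 0 < ε) (hε4 : ε ≤ 1 / 4)
    (hχ : ∀ w, IsClassicalScalarTransportOn (Icc 0 T) κ (fun τ x => -u (T - τ) x) (χ w))
    (hχ0 : ∀ w x, χ w 0 x = kernel ε (x - w)) (w : UnitAddTorus d) {τ : ℝ} (hτ : τ ∈ Icc 0 T) :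
    ∫ x, χ w τ x = 1 := by
  have h := (hχ w).scalarMean_eq subset_rfl hτ
  simp only [scalarMean] at h
  rw [h]
  simp_rw [hχ0]
  exact integral_kernel_sub hε hε4 w

/-- **Sup-norm equicontinuity in the parameter**: if `|k_ε(y - w) - k_ε(y - w')| ≤ η` for all
`y`, then `|χ^w(τ,x) - χ^{w'}(τ,x)| ≤ η` on `[0,T]` (sup-norm contraction). [folklore] -/
theorem reversedKernel_abs_sub_le (hκ : 0 ≤ κ)
    (hχ : ∀ w, IsClassicalScalarTransportOn (Icc 0 T) κ (fun τ x => -u (T - τ) x) (χ w))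
    (hχ0 : ∀ w x, χ w 0 x = kernel ε (x - w)) {w w' : UnitAddTorus d} {η : ℝ}
    (hη : ∀ y, |kernel ε (y - w) - kernel ε (y - w')| ≤ η) {τ : ℝ} (hτ : τ ∈ Icc 0 T)
    (x : UnitAddTorus d) : |χ w τ x - χ w' τ x| ≤ η :=
  IsClassicalScalarTransportOn.abs_sub_le hκ (hχ w) (hχ w') (fun y => by rw [hχ0, hχ0]; exact hη y) τ hτ x

omit [DecidableEq d] in
/-- Uniform continuity of the translated mollifiers in the translation parameter. [folklore] -/
theorem exists_forall_abs_kernel_sub_lt (hε : 0 < ε) (hε4 : ε ≤ 1 / 4) {η : ℝ} (hη : 0 < η) :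
    ∃ ρ > 0, ∀ w w' : UnitAddTorus d, dist w w' < ρ → ∀ y, |kernel ε (y - w) - kernel ε (y - w')| < η := by
  obtain ⟨ρ, hρ, h⟩ := Metric.uniformContinuous_iff.1
    (CompactSpace.uniformContinuous_of_continuous (continuous_kernel (d := d) hε hε4)) η hη
  refine ⟨ρ, hρ, fun w w' hw y => ?_⟩
  have hd : dist (y - w) (y - w') < ρ := by
    rw [dist_eq_norm, sub_sub_sub_cancel_left, ← dist_eq_norm, dist_comm]; exact hw
  have := h hd
  rwa [Real.dist_eq] at this

/-- **Joint continuity of the reversed kernel family** on `T^d × ([0,T] × T^d)`: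
`(w, τ, x) ↦ χ^w(τ, x)` is continuous (equicontinuity in `w`, joint continuity in `(τ, x)`).
[folklore] -/
theorem continuousOn_reversedKernel (hκ : 0 ≤ κ) (hε : 0 < ε) (hε4 : ε ≤ 1 / 4)
    (hχ : ∀ w, IsClassicalScalarTransportOn (Icc 0 T) κ (fun τ x => -u (T - τ) x) (χ w))
    (hχ0 : ∀ w x, χ w 0 x = kernel ε (x - w)) :
    ContinuousOn (fun q : UnitAddTorus d × (ℝ × UnitAddTorus d) => χ q.1 q.2.1 q.2.2)
      (univ ×ˢ (Icc 0 T ×ˢ univ)) := by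
  rintro ⟨w, τ, x⟩ ⟨-, hτ, -⟩
  rw [ContinuousWithinAt, Metric.tendsto_nhds]
  intro δ hδ
  obtain ⟨ρ, hρ, hρk⟩ := exists_forall_abs_kernel_sub_lt (d := d) hε hε4 (half_pos hδ)
  have hc2 : ContinuousWithinAt (uncurry (χ w)) (Icc 0 T ×ˢ univ) (τ, x) :=
    (hχ w).smooth_scalar.continuousOn_uncurry (τ, x) ⟨hτ, mem_univ _⟩
  have h2 : ∀ᶠ p : ℝ × UnitAddTorus d in 𝓝[Icc 0 T ×ˢ univ] (τ, x),
      dist (χ w p.1 p.2) (χ w τ x) < δ / 2 ∧ p ∈ Icc 0 T ×ˢ (univ : Set (UnitAddTorus d)) :=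
    (Metric.tendsto_nhds.1 hc2 _ (half_pos hδ)).and eventually_mem_nhdsWithin
  have h1 : ∀ᶠ w' : UnitAddTorus d in 𝓝[univ] w, dist w' w < ρ := by
    rw [nhdsWithin_univ]; exact Metric.tendsto_nhds.1 continuousAt_id _ hρ |>.mono fun w' h => h
  have h12 : ∀ᶠ q : UnitAddTorus d × (ℝ × UnitAddTorus d) in 𝓝[univ ×ˢ (Icc 0 T ×ˢ univ)] (w, τ, x),
      dist q.1 w < ρ ∧ (dist (χ w q.2.1 q.2.2) (χ w τ x) < δ / 2 ∧ q.2 ∈ Icc 0 T ×ˢ (univ : Set (UnitAddTorus d))) := by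
    rw [nhdsWithin_prod_eq]
    exact h1.prod_mk h2
  filter_upwards [h12] with q hq
  obtain ⟨hq1, hq2, hqτ, -⟩ := hq
  have hA : |χ q.1 q.2.1 q.2.2 - χ w q.2.1 q.2.2| ≤ δ / 2 :=
    reversedKernel_abs_sub_le hκ hχ hχ0 (fun y => (hρk q.1 w hq1 y).le) hqτ q.2.2
  calc dist (χ q.1 q.2.1 q.2.2) (χ w τ x)
      ≤ dist (χ q.1 q.2.1 q.2.2) (χ w q.2.1 q.2.2) + dist (χ w q.2.1 q.2.2) (χ w τ x) := dist_triangle _ _ _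
    _ < δ / 2 + δ / 2 := by
        refine add_lt_add_of_le_of_lt (by rwa [Real.dist_eq]) hq2
    _ = δ := add_halves δ

/-- Joint continuity in `(w, x)` at a fixed time. [folklore] -/
theorem continuous_reversedKernel_slice (hκ : 0 ≤ κ) (hε : 0 < ε) (hε4 : ε ≤ 1 / 4)
    (hχ : ∀ w, IsClassicalScalarTransportOn (Icc 0 T) κ (fun τ x => -u (T - τ) x) (χ w))
    (hχ0 : ∀ w x, χ w 0 x = kernel ε (x - w)) {τ : ℝ} (hτ : τ ∈ Icc 0 T) :
    Continuous (fun q : UnitAddTorus d × UnitAddTorus d => χ q.1 τ q.2) := by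
  have h := continuousOn_reversedKernel hκ hε hε4 hχ hχ0
  have hι : Continuous (fun q : UnitAddTorus d × UnitAddTorus d => ((q.1, (τ, q.2)) : UnitAddTorus d × (ℝ × UnitAddTorus d))) :=
    continuous_fst.prodMk (continuous_const.prodMk continuous_snd)
  exact h.comp_continuous hι fun q => ⟨mem_univ _, hτ, mem_univ _⟩

/-- Continuity of `w ↦ χ^w(τ, x)`. [folklore] -/
theorem continuous_reversedKernel_param (hκ : 0 ≤ κ) (hε : 0 < ε) (hε4 : ε ≤ 1 / 4)
    (hχ : ∀ w, IsClassicalScalarTransportOn (Icc 0 T) κ (fun τ x => -u (T - τ) x) (χ w))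
    (hχ0 : ∀ w x, χ w 0 x = kernel ε (x - w)) {τ : ℝ} (hτ : τ ∈ Icc 0 T) (x : UnitAddTorus d) :
    Continuous (fun w : UnitAddTorus d => χ w τ x) :=
  (continuous_reversedKernel_slice hκ hε hε4 hχ hχ0 hτ).comp (continuous_id.prodMk continuous_const)

/-- The superposition `m(τ, x) = ∫ χ^w(τ, x) dw` is continuous in `x`. [folklore] -/
theorem continuous_integral_reversedKernel (hκ : 0 ≤ κ) (hε : 0 < ε) (hε4 : ε ≤ 1 / 4)
    (hχ : ∀ w, IsClassicalScalarTransportOn (Icc 0 T) κ (fun τ x => -u (T - τ) x) (χ w))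
    (hχ0 : ∀ w x, χ w 0 x = kernel ε (x - w)) {τ : ℝ} (hτ : τ ∈ Icc 0 T) :
    Continuous (fun x : UnitAddTorus d => ∫ w, χ w τ x) := by
  have h := continuous_reversedKernel_slice hκ hε hε4 hχ hχ0 hτ
  have h' : Continuous (uncurry fun (x : UnitAddTorus d) (w : UnitAddTorus d) => χ w τ x) :=
    h.comp (continuous_snd.prodMk continuous_fst)
  have := continuous_parametric_integral_of_continuous h' (isCompact_univ (X := UnitAddTorus d)) (μ := volume)
  simpa only [Measure.restrict_univ] using this

end Family

end Torus

end Literature.Analysis.FluidPDE
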